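import Summits.BirchSwinnertonDyer.BirchSwinnertonDyer.Theorems.QuadraticBranchSignedControlPlusEtaNonsurjThetaFunctionalEquationNormCoordinateFactorisation
import HarnessLib

/-!
# Route `QuadraticBranchSignedControl` (rung K8, cell `bsd-potss`), residual crux `PlusEtaMainConjectureNonsurj`
# (stmt-BirchSwinnertonDyer-19606): THE FUNCTIONAL EQUATION ON THE QUADRATIC BRANCH, XXXVII — THE QUADRATIC NORM POLYNOMIAL DECIDED:
# for `H = Z² + h₁Z + h₀ ∈ ℤ_p[Z]` (`k = 2`: 14 of the 44 level-4 rows) the factorisation type over `ℤ_p` from `(v(h₀), v(h₁))` and ONE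
# residue symbol — **`2v(h₁) < v(h₀)` ⟹ SPLIT**; **`2v(h₁) > v(h₀)` odd ⟹ IRREDUCIBLE** (non-integral slope); **`2v(h₁) > v(h₀) = 2w` ⟹ split iff
# `−h₀/p^{2w}` is a square mod `p`**; **`2v(h₁) = v(h₀) = 2w`, `D = (h₁/p^w)² − 4h₀/p^{2w}`: non-residue ⟹ irreducible, nonzero residue ⟹ split**
# (seat `bsd-potss-k8eta-c2` g31; kernel, fact-free)

WHY. Part XXXIV decided the type of a quadratic norm polynomial in two situations (`v(h₀) = 1`: Eisenstein; `v(h₁) = 1 ∧ v(h₀) ≥ 3`: split;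
`v(h₀) = 2`: residual discriminant) and left P-31F with `k = 2` rows undecided (cm27a4_101, cm36a2_133, cm36a2_61: both digits `≡ 0 (25)`;
cmsextic_m49: `v(h₁) = 2`, `v(h₀) ≥ 3`). THIS FILE gives the COMPLETE decision for a monic quadratic over `ℤ_p` (`p` odd where a square root of
a residue is lifted) in terms of the Newton polygon of `Z² + h₁Z + h₀` — i.e. of `v₀ = v(h₀)`, `v₁ = v(h₁)` — and one Legendre symbol, each case
with an ALGEBRAIC proof (ultrametric inequality + Hensel), so that every further digit the census produces is read by a theorem:
* (§107) Vieta: a root `z` has the partner `z' = −h₁ − z`, `zz' = h₀`, `H = (Z − z)(Z − z')`;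
* (§108) **`2v₁ > v₀` with `v₀` ODD ⟹ no root** (`‖z‖ ≠ ‖z'‖` would force `‖h₁‖ = max(‖z‖, ‖z'‖)`, `‖h₁‖² ≥ ‖h₀‖`; `‖z‖ = ‖z'‖` would make `v₀`
  even) — cmsextic_m49 if its third digit gives `v₀ = 3`;
* (§109) **`2v₁ > v₀ = 2w`**: a root has `‖z‖ = p^{−w}`, `z = p^w y`, `y² ≡ −b (mod p)` with `h₀ = p^{2w}b`: **no root if `−b` is a non-residue,
  SPLIT (Hensel on `Y² + paY + b`) if `−b` is a nonzero residue**;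
* (§110) **`2v₁ = v₀ = 2w`** (`h₁ = p^w a`, `h₀ = p^{2w} b`), `D = a² − 4b`: a root has `‖z‖ ≤ p^{−w}` (the strictly largest term of
  `z² + h₁z + h₀` would survive), so `(2y + a)² = D`: **non-residue ⟹ no root (Part XXXIV §102 is `w = 1`); `D` a nonzero residue ⟹ SPLIT**
  (Hensel at `y₀ = (x₀ − a)/2`);
* (§111) **`2v₁ < v₀` ⟹ SPLIT** with `‖z₁‖ < ‖h₁‖ = ‖z₂‖` (Part XXXIV §103 with `‖h₁‖` arbitrary).
Every "no root" gives IRREDUCIBLE (monic quadratic over a domain) hence the all-or-nothing Kato reading `H_alg ∈ {1, H_an}` (Part XXXIV §100);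
every SPLIT gives `H_alg ∈ {1, Z − z₁, Z − z₂, H_an}` (Part XXXIV §104). The only inputs left undecided by these theorems are `D ≡ 0` resp.
`b ≡ 0 (mod p)` at the given scale — i.e. "one more digit".

WHAT (17 theorems). §107 `conj_root_of_natDegree_two`, `eq_mul_of_root_of_natDegree_two`; §108 `norm_mul_le_sq_max`, **`eval_ne_zero_of_odd_of_sq_lt`**,
`irreducible_of_forall_eval_ne_zero`, **`irreducible_of_odd_of_sq_lt`**; §109 `norm_root_eq_of_sq_lt`, `zpow_neg_natCast_eq_inv_pow`, `exists_eq_pow_mul_of_norm_le`,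
`eval_pow_mul_of_coeff`, **`eval_ne_zero_of_even_of_sq_lt_of_nonsquare`**, `norm_eq_one_of_not_dvd`, **`exists_split_of_even_of_sq_lt_of_square`**; §110
`norm_root_le_of_scale`, **`eval_ne_zero_of_scale_of_residualDisc_nonsquare`**, **`exists_split_of_scale_of_residualDisc_square`**; §111
**`exists_split_of_norm_coeff_lt_sq`**.

HONEST FRAMING (cell `bsd-potss`; FULL-BSD rank ≤ 1 programme, HUMAN RULING D-0036/D-0074): TOOL THEOREMS ONLY — `p`-adic algebra of monic
quadratics; no definition, no named fact, no `sorry`, axioms standard; row names are census labels; nothing about (A), (C1⁺_η), C-cc-1 or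
`BSD(W,p)` of any pair is claimed; no stub of 19606 is proved; crux and route OPEN; nothing booked. `--supports stmt-BirchSwinnertonDyer-19606`.

References: [Washington1997] §7.1; K. Conrad, Hensel's lemma (Mathlib `hensels_lemma`); Newton polygons (Koblitz, p-adic Numbers, IV.3 — used only
as a guide; every case is proved directly). Tree: Part XXXIV (`eval_eq_of_natDegree_two`, `eq_quadratic_of_monic`).
-/

set_option autoImplicit false
set_option linter.dupNamespace false
noncomputable section

open scoped Classical Topology

open PowerSeries Literature.NumberTheory.EllipticCurves Literature.NumberTheory.EllipticCurves.IwasawaAlgebra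

namespace Summit.BirchSwinnertonDyer.BirchSwinnertonDyer.Theorems.EtaThetaFunctionalEquation

variable {p : ℕ} [hp : Fact p.Prime]

/-! ## §107 Vieta for a monic quadratic with a root -/

/-- **Vieta.** If `H = Z² + h₁Z + h₀` has the root `z`, then `z' = −h₁ − z` is a root, `z + z' = −h₁`, `z·z' = h₀`. [folklore] -/
theorem conj_root_of_natDegree_two {H : Polynomial ℤ_[p]} (hmon : H.Monic) (h2 : H.natDegree = 2) {z : ℤ_[p]} (hz : H.eval z = 0) :
    H.eval (-H.coeff 1 - z) = 0 ∧ z + (-H.coeff 1 - z) = -H.coeff 1 ∧ z * (-H.coeff 1 - z) = H.coeff 0 := by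
  rw [eval_eq_of_natDegree_two hmon h2] at hz ⊢
  refine ⟨by linear_combination hz, by ring, by linear_combination -hz⟩

/-- **`H = (Z − z)(Z − z')`** for a root `z` and its partner `z' = −h₁ − z`. [folklore] -/
theorem eq_mul_of_root_of_natDegree_two {H : Polynomial ℤ_[p]} (hmon : H.Monic) (h2 : H.natDegree = 2) {z : ℤ_[p]} (hz : H.eval z = 0) :
    H = (Polynomial.X - Polynomial.C z) * (Polynomial.X - Polynomial.C (-H.coeff 1 - z)) := by
  obtain ⟨-, hs, hprod⟩ := conj_root_of_natDegree_two hmon h2 hz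
  conv_lhs => rw [eq_quadratic_of_monic hmon h2]
  have e1 : Polynomial.C (H.coeff 1) = -(Polynomial.C z + Polynomial.C (-H.coeff 1 - z)) := by
    rw [← Polynomial.C_add, hs, Polynomial.C_neg, neg_neg]
  have e0 : Polynomial.C (H.coeff 0) = Polynomial.C z * Polynomial.C (-H.coeff 1 - z) := by rw [← Polynomial.C_mul, hprod]
  rw [e1, e0]
  ring

/-! ## §108 Non-integral slope: `2v(h₁) > v(h₀)` odd ⟹ irreducible -/

/-- `‖z‖·‖z'‖ ≤ max(‖z‖, ‖z'‖)²`. [folklore] -/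
theorem norm_mul_le_sq_max (z z' : ℤ_[p]) : ‖z‖ * ‖z'‖ ≤ max ‖z‖ ‖z'‖ ^ 2 := by
  rw [sq]
  exact mul_le_mul (le_max_left _ _) (le_max_right _ _) (norm_nonneg _) ((norm_nonneg _).trans (le_max_left _ _))

/-- **NON-INTEGRAL SLOPE ⟹ NO ROOT.** `H = Z² + h₁Z + h₀` monic with `‖h₀‖ = p^{−(2m+1)}` (odd valuation) and `‖h₁‖² < ‖h₀‖` (`2v(h₁) > v(h₀)`) has no
root in `ℤ_p`: for a root `z` with partner `z'`, `‖z‖‖z'‖ = ‖h₀‖`; `‖z‖ = ‖z'‖` would make `v(h₀)` even, and `‖z‖ ≠ ‖z'‖` gives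
`‖h₁‖ = ‖z + z'‖ = max(‖z‖, ‖z'‖)`, `‖h₁‖² ≥ ‖h₀‖`. [folklore] -/
theorem eval_ne_zero_of_odd_of_sq_lt {H : Polynomial ℤ_[p]} (hmon : H.Monic) (h2 : H.natDegree = 2) {m : ℕ}
    (hodd : ‖H.coeff 0‖ = (p : ℝ) ^ (-(2 * (m : ℤ) + 1))) (hsl : ‖H.coeff 1‖ ^ 2 < ‖H.coeff 0‖) (z : ℤ_[p]) : H.eval z ≠ 0 := by
  intro hz
  obtain ⟨-, hs, hprod⟩ := conj_root_of_natDegree_two hmon h2 hz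
  set z' := -H.coeff 1 - z with hz'
  have hp1 : (1 : ℝ) < p := Nat.one_lt_cast.mpr hp.out.one_lt
  have hnorm0 : ‖z‖ * ‖z'‖ = ‖H.coeff 0‖ := by rw [← norm_mul, hprod]
  by_cases hzz : ‖z‖ = ‖z'‖
  · have hz0 : z ≠ 0 := by
      rintro rfl
      rw [norm_zero, zero_mul] at hnorm0
      rw [← hnorm0] at hodd
      exact (zpow_pos (by positivity) _).ne hodd
    rw [← hzz, PadicInt.norm_eq_zpow_neg_valuation hz0, ← zpow_add₀ (by positivity), hodd,
      zpow_right_inj₀ (by positivity) hp1.ne'] at hnorm0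
    omega
  · have hmax : ‖H.coeff 1‖ = max ‖z‖ ‖z'‖ := by rw [← norm_neg, ← hs, PadicInt.norm_add_eq_max_of_ne hzz]
    have hle : ‖H.coeff 0‖ ≤ ‖H.coeff 1‖ ^ 2 := by rw [← hnorm0, hmax]; exact norm_mul_le_sq_max z z'
    exact absurd hsl (not_lt.mpr hle)

/-- A monic quadratic over `ℤ_p` without roots is irreducible. [folklore] -/
theorem irreducible_of_forall_eval_ne_zero {H : Polynomial ℤ_[p]} (hmon : H.Monic) (h2 : H.natDegree = 2) (hno : ∀ z, H.eval z ≠ 0) :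
    Irreducible H :=
  (hmon.irreducible_iff_roots_eq_zero_of_degree_le_three (by omega) (by omega)).mpr
    (Multiset.eq_zero_of_forall_notMem fun z hz ↦ hno z ((Polynomial.mem_roots hmon.ne_zero).mp hz))

/-- **NON-INTEGRAL SLOPE ⟹ IRREDUCIBLE** (`‖h₀‖ = p^{−(2m+1)}`, `‖h₁‖² < ‖h₀‖`). [folklore] -/
theorem irreducible_of_odd_of_sq_lt {H : Polynomial ℤ_[p]} (hmon : H.Monic) (h2 : H.natDegree = 2) {m : ℕ}
    (hodd : ‖H.coeff 0‖ = (p : ℝ) ^ (-(2 * (m : ℤ) + 1))) (hsl : ‖H.coeff 1‖ ^ 2 < ‖H.coeff 0‖) : Irreducible H :=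
  irreducible_of_forall_eval_ne_zero hmon h2 (eval_ne_zero_of_odd_of_sq_lt hmon h2 hodd hsl)

/-! ## §109 `2v(h₁) > v(h₀) = 2w`: roots have norm `p^{−w}`; decided by the residue of `−h₀/p^{2w}` -/

/-- Under `‖h₁‖² < ‖h₀‖ = p^{−2w}` a root `z` (and its partner) has `‖z‖ = p^{−w}`. [folklore] -/
theorem norm_root_eq_of_sq_lt {H : Polynomial ℤ_[p]} (hmon : H.Monic) (h2 : H.natDegree = 2) {w : ℕ}
    (hev : ‖H.coeff 0‖ = ((p : ℝ)⁻¹) ^ (2 * w)) (hsl : ‖H.coeff 1‖ ^ 2 < ‖H.coeff 0‖) {z : ℤ_[p]} (hz : H.eval z = 0) :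
    ‖z‖ = ((p : ℝ)⁻¹) ^ w := by
  obtain ⟨-, hs, hprod⟩ := conj_root_of_natDegree_two hmon h2 hz
  set z' := -H.coeff 1 - z with hz'
  have hp0 : (0 : ℝ) < p := by have := hp.out.pos; positivity
  have hnorm0 : ‖z‖ * ‖z'‖ = ‖H.coeff 0‖ := by rw [← norm_mul, hprod]
  have hzz : ‖z‖ = ‖z'‖ := by
    by_contra hzz
    have hmax : ‖H.coeff 1‖ = max ‖z‖ ‖z'‖ := by rw [← norm_neg, ← hs, PadicInt.norm_add_eq_max_of_ne hzz]
    have hle : ‖H.coeff 0‖ ≤ ‖H.coeff 1‖ ^ 2 := by rw [← hnorm0, hmax]; exact norm_mul_le_sq_max z z'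
    exact absurd hsl (not_lt.mpr hle)
  rw [← hzz, hev, ← sq, show 2 * w = w * 2 by ring, pow_mul] at hnorm0
  exact (pow_left_inj₀ (norm_nonneg _) (by positivity) two_ne_zero).mp hnorm0

omit hp in
/-- `(p : ℝ)^{−n} = (p⁻¹)^n`. [folklore] -/
theorem zpow_neg_natCast_eq_inv_pow (n : ℕ) : (p : ℝ) ^ (-(n : ℤ)) = ((p : ℝ)⁻¹) ^ n := by
  rw [zpow_neg, zpow_natCast, inv_pow]

/-- `‖z‖ ≤ p^{−w}` ⟹ `z = p^w·y`. [folklore] -/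
theorem exists_eq_pow_mul_of_norm_le {z : ℤ_[p]} {w : ℕ} (hz : ‖z‖ ≤ ((p : ℝ)⁻¹) ^ w) : ∃ y : ℤ_[p], z = (p : ℤ_[p]) ^ w * y := by
  rw [← zpow_neg_natCast_eq_inv_pow, PadicInt.norm_le_pow_iff_mem_span_pow, Ideal.mem_span_singleton] at hz
  exact hz

/-- `H(p^w y) = p^{2w}·(y² + p·a·y + b)` when `h₁ = p^{w+1}a`, `h₀ = p^{2w}b`. [folklore] -/
theorem eval_pow_mul_of_coeff {H : Polynomial ℤ_[p]} (hmon : H.Monic) (h2 : H.natDegree = 2) {w : ℕ} {a b : ℤ_[p]}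
    (h1 : H.coeff 1 = (p : ℤ_[p]) ^ (w + 1) * a) (h0 : H.coeff 0 = (p : ℤ_[p]) ^ (2 * w) * b) (y : ℤ_[p]) :
    H.eval ((p : ℤ_[p]) ^ w * y) = (p : ℤ_[p]) ^ (2 * w) * (y ^ 2 + p * a * y + b) := by
  rw [eval_eq_of_natDegree_two hmon h2, h1, h0]; ring

/-- **`2v(h₁) > v(h₀) = 2w`, NON-RESIDUE ⟹ NO ROOT.** `h₁ = p^{w+1}a`, `h₀ = p^{2w}b` with `p ∤ b` and `−b` not a square mod `p`
(`∀ x, p ∤ x² + b`): a root has norm `p^{−w}`, is `p^w y`, and `y² + pay + b = 0` gives `p ∣ y² + b`. [folklore] -/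
theorem eval_ne_zero_of_even_of_sq_lt_of_nonsquare {H : Polynomial ℤ_[p]} (hmon : H.Monic) (h2 : H.natDegree = 2) {w : ℕ} {a b : ℤ_[p]}
    (h1 : H.coeff 1 = (p : ℤ_[p]) ^ (w + 1) * a) (h0 : H.coeff 0 = (p : ℤ_[p]) ^ (2 * w) * b) (hb : ¬ (p : ℤ_[p]) ∣ b)
    (hD : ∀ x : ℤ_[p], ¬ (p : ℤ_[p]) ∣ x ^ 2 + b) (z : ℤ_[p]) : H.eval z ≠ 0 := by
  intro hz
  have hp1 : (1 : ℝ) < p := Nat.one_lt_cast.mpr hp.out.one_lt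
  have hq1 : ((p : ℝ)⁻¹) < 1 := inv_lt_one_of_one_lt₀ hp1
  have hq0 : (0 : ℝ) < (p : ℝ)⁻¹ := by positivity
  have hbn : ‖b‖ = 1 := by
    rcases (PadicInt.norm_le_one b).lt_or_eq with h | h
    · exact absurd ((PadicInt.norm_lt_one_iff_dvd b).mp h) hb
    · exact h
  have hev : ‖H.coeff 0‖ = ((p : ℝ)⁻¹) ^ (2 * w) := by rw [h0, norm_mul, norm_pow, PadicInt.norm_p, hbn, mul_one]
  have hsl : ‖H.coeff 1‖ ^ 2 < ‖H.coeff 0‖ := by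
    have hle : ‖H.coeff 1‖ ≤ ((p : ℝ)⁻¹) ^ (w + 1) := by
      rw [h1, norm_mul, norm_pow, PadicInt.norm_p]
      exact mul_le_of_le_one_right (by positivity) (PadicInt.norm_le_one a)
    calc ‖H.coeff 1‖ ^ 2 ≤ (((p : ℝ)⁻¹) ^ (w + 1)) ^ 2 := pow_le_pow_left₀ (norm_nonneg _) hle 2
      _ = ((p : ℝ)⁻¹) ^ (2 * w) * ((p : ℝ)⁻¹) ^ 2 := by ring
      _ < ((p : ℝ)⁻¹) ^ (2 * w) * 1 := by
          exact mul_lt_mul_of_pos_left (pow_lt_one₀ hq0.le hq1 two_ne_zero) (pow_pos hq0 _)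
      _ = ‖H.coeff 0‖ := by rw [mul_one, hev]
  have hzn := norm_root_eq_of_sq_lt hmon h2 hev hsl hz
  obtain ⟨y, rfl⟩ := exists_eq_pow_mul_of_norm_le hzn.le
  rw [eval_pow_mul_of_coeff hmon h2 h1 h0] at hz
  have hp0 : (p : ℤ_[p]) ^ (2 * w) ≠ 0 := pow_ne_zero _ (Nat.cast_ne_zero.mpr hp.out.ne_zero)
  have hy : y ^ 2 + p * a * y + b = 0 := (mul_eq_zero.mp hz).resolve_left hp0
  exact hD y ⟨-(a * y), by linear_combination hy⟩

/-- `p ∤ x ⟹ ‖x‖ = 1` in `ℤ_p`. [folklore] -/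
theorem norm_eq_one_of_not_dvd {x : ℤ_[p]} (hx : ¬ (p : ℤ_[p]) ∣ x) : ‖x‖ = 1 := by
  rcases (PadicInt.norm_le_one x).lt_or_eq with h | h
  · exact absurd ((PadicInt.norm_lt_one_iff_dvd x).mp h) hx
  · exact h

/-- **`2v(h₁) > v(h₀) = 2w`, RESIDUE ⟹ SPLIT.** `p` odd, `h₁ = p^{w+1}a`, `h₀ = p^{2w}b`, `p ∤ b`, `p ∣ y₀² + b` for some `y₀`: Hensel's lemma for
`G(Y) = Y² + paY + b` at `y₀` (`‖G(y₀)‖ < 1 = ‖G'(y₀)‖²`, `G'(y₀) = 2y₀ + pa` a unit) gives a root `y`, and `z = p^w y` is a root of `H`: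
**`H = (Z − z)(Z − z')`**. [folklore] -/
theorem exists_split_of_even_of_sq_lt_of_square (hp2 : p ≠ 2) {H : Polynomial ℤ_[p]} (hmon : H.Monic) (h2 : H.natDegree = 2) {w : ℕ}
    {a b : ℤ_[p]} (h1 : H.coeff 1 = (p : ℤ_[p]) ^ (w + 1) * a) (h0 : H.coeff 0 = (p : ℤ_[p]) ^ (2 * w) * b) (hb : ¬ (p : ℤ_[p]) ∣ b)
    {y₀ : ℤ_[p]} (hy₀ : (p : ℤ_[p]) ∣ y₀ ^ 2 + b) :
    ∃ z₁ z₂ : ℤ_[p], H = (Polynomial.X - Polynomial.C z₁) * (Polynomial.X - Polynomial.C z₂) ∧ H.eval z₁ = 0 ∧ H.eval z₂ = 0 := by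
  obtain ⟨r, hr⟩ := exists_two_mul_eq_neg_one (p := p) hp2
  set G : Polynomial ℤ_[p] := Polynomial.X ^ 2 + Polynomial.C ((p : ℤ_[p]) * a) * Polynomial.X + Polynomial.C b with hG
  have hGev : ∀ x : ℤ_[p], G.eval x = x ^ 2 + p * a * x + b := fun x ↦ by simp [hG]
  have hGder : ∀ x : ℤ_[p], G.derivative.eval x = 2 * x + p * a := fun x ↦ by
    simp only [hG, Polynomial.derivative_add, Polynomial.derivative_X_pow, Polynomial.derivative_mul, Polynomial.derivative_C,
      Polynomial.derivative_X, zero_mul, mul_one, zero_add, add_zero, Polynomial.eval_add, Polynomial.eval_mul,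
      Polynomial.eval_C, Polynomial.eval_X, Polynomial.eval_pow, Nat.cast_ofNat, map_ofNat, Polynomial.eval_ofNat]
    ring
  -- `y₀` is a unit
  have hy₀u : ¬ (p : ℤ_[p]) ∣ y₀ := fun ⟨c, hc⟩ ↦ hb (by
    obtain ⟨d, hd⟩ := hy₀
    exact ⟨d - p * c ^ 2, by linear_combination hd - (y₀ + p * c) * hc⟩)
  have hder1 : ‖G.derivative.eval y₀‖ = 1 := by
    rw [hGder]
    refine norm_eq_one_of_not_dvd fun ⟨c, hc⟩ ↦ hy₀u ⟨-r * (c - a), ?_⟩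
    linear_combination (-r) * hc + y₀ * hr
  have hG0 : ‖G.eval y₀‖ < 1 := by
    rw [hGev, PadicInt.norm_lt_one_iff_dvd]
    obtain ⟨d, hd⟩ := hy₀
    exact ⟨d + a * y₀, by linear_combination hd⟩
  have hn : ‖Polynomial.aeval y₀ G‖ < ‖Polynomial.aeval y₀ (Polynomial.derivative G)‖ ^ 2 := by
    rw [Polynomial.coe_aeval_eq_eval, hder1, one_pow]; exact hG0
  obtain ⟨y, hy, -, -, -⟩ := hensels_lemma hn
  rw [Polynomial.coe_aeval_eq_eval, hGev] at hy
  have hz : H.eval ((p : ℤ_[p]) ^ w * y) = 0 := by rw [eval_pow_mul_of_coeff hmon h2 h1 h0, hy, mul_zero]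
  exact ⟨_, _, eq_mul_of_root_of_natDegree_two hmon h2 hz, hz, (conj_root_of_natDegree_two hmon h2 hz).1⟩

/-! ## §110 `2v(h₁) = v(h₀) = 2w`: the residual discriminant at scale `w` -/

/-- Under `h₁ = p^w a`, `h₀ = p^{2w} b` every root has `‖z‖ ≤ p^{−w}` (otherwise `z²` is the strictly largest term of `z² + h₁z + h₀ = 0`). [folklore] -/
theorem norm_root_le_of_scale {H : Polynomial ℤ_[p]} (hmon : H.Monic) (h2 : H.natDegree = 2) {w : ℕ} {a b : ℤ_[p]}
    (h1 : H.coeff 1 = (p : ℤ_[p]) ^ w * a) (h0 : H.coeff 0 = (p : ℤ_[p]) ^ (2 * w) * b) {z : ℤ_[p]} (hz : H.eval z = 0) :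
    ‖z‖ ≤ ((p : ℝ)⁻¹) ^ w := by
  by_contra hlt
  rw [not_le] at hlt
  have hq0 : (0 : ℝ) ≤ ((p : ℝ)⁻¹) ^ w := by positivity
  have hz0 : 0 < ‖z‖ := hq0.trans_lt hlt
  rw [eval_eq_of_natDegree_two hmon h2] at hz
  have hA : ‖H.coeff 1 * z‖ < ‖z ^ 2‖ := by
    rw [norm_mul, norm_pow, h1, norm_mul, norm_pow, PadicInt.norm_p, sq]
    calc ((p : ℝ)⁻¹) ^ w * ‖a‖ * ‖z‖ ≤ ((p : ℝ)⁻¹) ^ w * 1 * ‖z‖ := by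
          exact mul_le_mul_of_nonneg_right (mul_le_mul_of_nonneg_left (PadicInt.norm_le_one a) hq0) (norm_nonneg _)
      _ < ‖z‖ * ‖z‖ := by rw [mul_one]; exact mul_lt_mul_of_pos_right hlt hz0
  have hB : ‖H.coeff 0‖ < ‖z ^ 2‖ := by
    rw [norm_pow, h0, norm_mul, norm_pow, PadicInt.norm_p, two_mul, pow_add, sq]
    calc ((p : ℝ)⁻¹) ^ w * ((p : ℝ)⁻¹) ^ w * ‖b‖ ≤ ((p : ℝ)⁻¹) ^ w * ((p : ℝ)⁻¹) ^ w * 1 :=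
          mul_le_mul_of_nonneg_left (PadicInt.norm_le_one b) (by positivity)
      _ < ‖z‖ * ‖z‖ := by rw [mul_one]; exact mul_lt_mul'' hlt hlt hq0 hq0
  have hC : ‖H.coeff 1 * z + H.coeff 0‖ < ‖z ^ 2‖ := (PadicInt.nonarchimedean _ _).trans_lt (max_lt hA hB)
  have hD : ‖z ^ 2 + (H.coeff 1 * z + H.coeff 0)‖ = ‖z ^ 2‖ := by
    rw [PadicInt.norm_add_eq_max_of_ne hC.ne', max_eq_left hC.le]
  rw [show z ^ 2 + (H.coeff 1 * z + H.coeff 0) = z ^ 2 + H.coeff 1 * z + H.coeff 0 by ring, hz, norm_zero] at hD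
  rw [← hD] at hB
  exact absurd hB (not_lt.mpr (norm_nonneg _))

/-- **`2v(h₁) = v(h₀) = 2w`, RESIDUAL DISCRIMINANT A NON-RESIDUE ⟹ NO ROOT** (`h₁ = p^w a`, `h₀ = p^{2w} b`, `D = a² − 4b`, `∀ x, p ∤ x² − D`):
a root is `p^w y` with `y² + ay + b = 0`, `(2y + a)² = D`. Part XXXIV's `eval_ne_zero_of_residualDisc_nonsquare` is `w = 1`. [folklore] -/
theorem eval_ne_zero_of_scale_of_residualDisc_nonsquare {H : Polynomial ℤ_[p]} (hmon : H.Monic) (h2 : H.natDegree = 2) {w : ℕ}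
    {a b : ℤ_[p]} (h1 : H.coeff 1 = (p : ℤ_[p]) ^ w * a) (h0 : H.coeff 0 = (p : ℤ_[p]) ^ (2 * w) * b)
    (hD : ∀ x : ℤ_[p], ¬ (p : ℤ_[p]) ∣ x ^ 2 - (a ^ 2 - 4 * b)) (z : ℤ_[p]) : H.eval z ≠ 0 := by
  intro hz
  obtain ⟨y, rfl⟩ := exists_eq_pow_mul_of_norm_le (norm_root_le_of_scale hmon h2 h1 h0 hz)
  rw [eval_eq_of_natDegree_two hmon h2, h1, h0] at hz
  have hp0 : (p : ℤ_[p]) ^ (2 * w) ≠ 0 := pow_ne_zero _ (Nat.cast_ne_zero.mpr hp.out.ne_zero)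
  have hy : y ^ 2 + a * y + b = 0 := by
    have h' : (p : ℤ_[p]) ^ (2 * w) * (y ^ 2 + a * y + b) = 0 := by linear_combination hz
    exact (mul_eq_zero.mp h').resolve_left hp0
  exact hD (2 * y + a) ⟨0, by linear_combination 4 * hy⟩

/-- **`2v(h₁) = v(h₀) = 2w`, `D` A NONZERO RESIDUE ⟹ SPLIT** (`p` odd, `h₁ = p^w a`, `h₀ = p^{2w} b`, `D = a² − 4b`, `p ∤ D`, `p ∣ x₀² − D`): Hensel for
`G(Y) = Y² + aY + b` at `y₀ = (x₀ − a)/2` (`4G(y₀) = x₀² − D`, `G'(y₀) = x₀` a unit); `z = p^w y`, `H = (Z − z)(Z − z')`. [folklore] -/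
theorem exists_split_of_scale_of_residualDisc_square (hp2 : p ≠ 2) {H : Polynomial ℤ_[p]} (hmon : H.Monic) (h2 : H.natDegree = 2) {w : ℕ}
    {a b : ℤ_[p]} (h1 : H.coeff 1 = (p : ℤ_[p]) ^ w * a) (h0 : H.coeff 0 = (p : ℤ_[p]) ^ (2 * w) * b)
    (hD0 : ¬ (p : ℤ_[p]) ∣ a ^ 2 - 4 * b) {x₀ : ℤ_[p]} (hx₀ : (p : ℤ_[p]) ∣ x₀ ^ 2 - (a ^ 2 - 4 * b)) :
    ∃ z₁ z₂ : ℤ_[p], H = (Polynomial.X - Polynomial.C z₁) * (Polynomial.X - Polynomial.C z₂) ∧ H.eval z₁ = 0 ∧ H.eval z₂ = 0 := by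
  obtain ⟨r, hr⟩ := exists_two_mul_eq_neg_one (p := p) hp2
  set G : Polynomial ℤ_[p] := Polynomial.X ^ 2 + Polynomial.C a * Polynomial.X + Polynomial.C b with hG
  have hGev : ∀ x : ℤ_[p], G.eval x = x ^ 2 + a * x + b := fun x ↦ by simp [hG]
  have hGder : ∀ x : ℤ_[p], G.derivative.eval x = 2 * x + a := fun x ↦ by
    simp only [hG, Polynomial.derivative_add, Polynomial.derivative_X_pow, Polynomial.derivative_mul, Polynomial.derivative_C,
      Polynomial.derivative_X, zero_mul, mul_one, zero_add, add_zero, Polynomial.eval_add, Polynomial.eval_mul,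
      Polynomial.eval_C, Polynomial.eval_X, Polynomial.eval_pow, Nat.cast_ofNat, map_ofNat, Polynomial.eval_ofNat]
    ring
  set y₀ : ℤ_[p] := -r * (x₀ - a) with hy₀
  have h2y₀ : 2 * y₀ + a = x₀ := by rw [hy₀]; linear_combination (a - x₀) * hr
  have hx₀u : ¬ (p : ℤ_[p]) ∣ x₀ := fun ⟨c, hc⟩ ↦ hD0 (by
    obtain ⟨d, hd⟩ := hx₀
    exact ⟨p * c ^ 2 - d, by linear_combination -hd + (x₀ + p * c) * hc⟩)
  have hder1 : ‖G.derivative.eval y₀‖ = 1 := by rw [hGder, h2y₀]; exact norm_eq_one_of_not_dvd hx₀u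
  have hG0 : ‖G.eval y₀‖ < 1 := by
    rw [hGev, PadicInt.norm_lt_one_iff_dvd]
    obtain ⟨d, hd⟩ := hx₀
    -- `4·G(y₀) = (2y₀ + a)² − D = x₀² − D = p·d` and `4r² = 1`
    have e5 : (4 : ℤ_[p]) * r ^ 2 = 1 := by linear_combination (2 * r - 1) * hr
    exact ⟨r ^ 2 * d, by linear_combination r ^ 2 * hd - (y₀ ^ 2 + a * y₀ + b) * e5 + r ^ 2 * (x₀ + 2 * y₀ + a) * h2y₀⟩
  have hn : ‖Polynomial.aeval y₀ G‖ < ‖Polynomial.aeval y₀ (Polynomial.derivative G)‖ ^ 2 := by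
    rw [Polynomial.coe_aeval_eq_eval, hder1, one_pow]; exact hG0
  obtain ⟨y, hy, -, -, -⟩ := hensels_lemma hn
  rw [Polynomial.coe_aeval_eq_eval, hGev] at hy
  have hz : H.eval ((p : ℤ_[p]) ^ w * y) = 0 := by
    rw [eval_eq_of_natDegree_two hmon h2, h1, h0]
    linear_combination (p : ℤ_[p]) ^ (2 * w) * hy
  exact ⟨_, _, eq_mul_of_root_of_natDegree_two hmon h2 hz, hz, (conj_root_of_natDegree_two hmon h2 hz).1⟩

/-! ## §111 `2v(h₁) < v(h₀)`: split (Part XXXIV §103 with `‖h₁‖` arbitrary) -/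

/-- **`‖h₀‖ < ‖h₁‖²` (`2v(h₁) < v(h₀)`) ⟹ SPLIT: `H = (Z − z₁)(Z − z₂)` with `‖z₁‖ < ‖h₁‖ = ‖z₂‖`, `z₁ ≠ z₂`** (Hensel at `0` and at
`−h₁`; Part XXXIV's `exists_split_of_norm_coeff` is the case `‖h₁‖ = p⁻¹`). [folklore] -/
theorem exists_split_of_norm_coeff_lt_sq {H : Polynomial ℤ_[p]} (hmon : H.Monic) (h2 : H.natDegree = 2)
    (h0 : ‖H.coeff 0‖ < ‖H.coeff 1‖ ^ 2) :
    ∃ z₁ z₂ : ℤ_[p], H = (Polynomial.X - Polynomial.C z₁) * (Polynomial.X - Polynomial.C z₂) ∧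
      ‖z₁‖ < ‖H.coeff 1‖ ∧ ‖z₂‖ = ‖H.coeff 1‖ ∧ z₁ ≠ z₂ ∧ H.eval z₁ = 0 ∧ H.eval z₂ = 0 := by
  have hH := eq_quadratic_of_monic hmon h2
  have hev : ∀ x : ℤ_[p], H.eval x = x ^ 2 + H.coeff 1 * x + H.coeff 0 := eval_eq_of_natDegree_two hmon h2
  have hder : ∀ x : ℤ_[p], H.derivative.eval x = 2 * x + H.coeff 1 := fun x ↦ by
    conv_lhs => rw [hH]
    simp only [Polynomial.derivative_add, Polynomial.derivative_X_pow, Polynomial.derivative_mul, Polynomial.derivative_C,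
      Polynomial.derivative_X, zero_mul, mul_one, zero_add, add_zero, Polynomial.eval_add, Polynomial.eval_mul,
      Polynomial.eval_C, Polynomial.eval_X, Polynomial.eval_pow, Nat.cast_ofNat, map_ofNat, Polynomial.eval_ofNat]
    ring
  have e1 : H.eval 0 = H.coeff 0 := by rw [hev]; ring
  have e2 : H.derivative.eval 0 = H.coeff 1 := by rw [hder]; ring
  have e3 : H.eval (-H.coeff 1) = H.coeff 0 := by rw [hev]; ring
  have e4 : H.derivative.eval (-H.coeff 1) = -H.coeff 1 := by rw [hder]; ring
  -- Hensel at 0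
  have hn₁ : ‖Polynomial.aeval (0 : ℤ_[p]) H‖ < ‖Polynomial.aeval (0 : ℤ_[p]) (Polynomial.derivative H)‖ ^ 2 := by
    rw [Polynomial.coe_aeval_eq_eval, e1, e2]; exact h0
  obtain ⟨z₁, hz₁, hz₁a, -, -⟩ := hensels_lemma hn₁
  rw [Polynomial.coe_aeval_eq_eval] at hz₁ hz₁a
  rw [sub_zero, e2] at hz₁a
  -- Hensel at −h₁
  have hn₂ : ‖Polynomial.aeval (-H.coeff 1) H‖ < ‖Polynomial.aeval (-H.coeff 1) (Polynomial.derivative H)‖ ^ 2 := by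
    rw [Polynomial.coe_aeval_eq_eval, e3, e4, norm_neg]; exact h0
  obtain ⟨z₂, hz₂, hz₂a, -, -⟩ := hensels_lemma hn₂
  rw [Polynomial.coe_aeval_eq_eval] at hz₂ hz₂a
  rw [sub_neg_eq_add, e4, norm_neg] at hz₂a
  have hz₂n : ‖z₂‖ = ‖H.coeff 1‖ := by
    have e : z₂ = (z₂ + H.coeff 1) + -H.coeff 1 := by ring
    rw [e, PadicInt.norm_add_eq_max_of_ne (by rw [norm_neg]; exact hz₂a.ne), norm_neg, max_eq_right hz₂a.le]
  have hne : z₁ ≠ z₂ := fun h ↦ by rw [h, hz₂n] at hz₁a; exact lt_irrefl _ hz₁a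
  -- factor
  have hfac : (Polynomial.X - Polynomial.C z₂) * (H /ₘ (Polynomial.X - Polynomial.C z₂)) = H :=
    Polynomial.mul_divByMonic_eq_iff_isRoot.mpr hz₂
  set Q := H /ₘ (Polynomial.X - Polynomial.C z₂) with hQ
  have hQmon : Q.Monic := (Polynomial.monic_X_sub_C z₂).of_mul_monic_left (by rw [hfac]; exact hmon)
  have hQdeg : Q.natDegree = 1 := by
    rw [hQ, Polynomial.natDegree_divByMonic _ (Polynomial.monic_X_sub_C z₂), Polynomial.natDegree_X_sub_C, h2]
  have hQ1 : Q = Polynomial.X + Polynomial.C (Q.coeff 0) := hQmon.eq_X_add_C hQdeg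
  have hQz₁ : Q.coeff 0 = -z₁ := by
    have h := hz₁
    rw [← hfac, Polynomial.eval_mul, Polynomial.eval_sub, Polynomial.eval_X, Polynomial.eval_C, hQ1, Polynomial.eval_add, Polynomial.eval_X,
      Polynomial.eval_C] at h
    have h' := (mul_eq_zero.mp h).resolve_left (sub_ne_zero.mpr hne)
    linear_combination h'
  refine ⟨z₁, z₂, ?_, hz₁a, hz₂n, hne, hz₁, hz₂⟩
  rw [← hfac, hQ1, hQz₁, map_neg, ← sub_eq_add_neg, mul_comm]

end Summit.BirchSwinnertonDyer.BirchSwinnertonDyer.Theorems.EtaThetaFunctionalEquation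

end
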